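import Literature.MathematicalPhysics.QuantumFieldTheory.Balaban1983to89.B13OpsYPencilGreenPrimeSym
import Literature.MathematicalPhysics.QuantumFieldTheory.Balaban1983to89.B9Thm31SiteGpKernelTorusDecayReg335Y
import Literature.MathematicalPhysics.QuantumFieldTheory.Balaban1983to89.B13MatrixUnitBasisNumerals
import Literature.MathematicalPhysics.QuantumFieldTheory.Balaban1983to89.MatrixNorms

/-!
# `Balaban1983to89.B13GreenPrimeSymLettersOfReg335` — T. Bałaban, *Propagators for lattice gauge theories in a background field*, Commun. Math. Phys. **99** (1985)
# 389–434 [Balaban1985BackgroundPropagators], (3.24)–(3.25) p. 394, (3.35) p. 396, Thm 3.1 (3.42) p. 397 and (3.46) p. 398, Thm 3.4 and (3.50) p. 400, Sect. B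
# (3.60)–(3.65) p. 402, Thm 3.10 (3.107)–(3.108) p. 416; *Renormalization group approach to lattice gauge field theories. II*, Commun. Math. Phys. **116** (1988) 1–22
# [Balaban1988RG2Cluster] (2.5)–(2.7) pp. 12–13, p. 15: ★★★ THE N06 → N10 KNIT FOR THE G′-FACTOR — `G′(e^{iηA′}U₀)` HAS THE N10 ENTRY LETTERS ALONG pv27's PENCIL FOR
# EVERY BACKGROUND `U₀` OF THE (3.35) CLASS, WITH NO N06 HYPOTHESIS DISPLAYED.

THE KNIT.  The N10 junction's letter datum for an inverse factor is produced by the located Neumann road (modules 58 ∕ `B13InverseOperatorCoordinates`) from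
(i) the pencil letters of the un-inverted operator and (ii) two facts AT THE ONE REAL BACKGROUND: invertibility and a (3.108)-type kernel bound of the inverse.
For `G′ = (Δ′_a)⁻¹` at def-Y's v4 letter `parSymY`, (i) is module 78 (`B13OpsYPencilGreenPrimeSym`), and (ii) ARE TREE THEOREMS of the N06 lanes on the class
(3.35): dag-n06-j's `B9Thm311DeltaPrimePos.isUnit_deltaPrimeAY_parSymY` (Δ′_a(U) is invertible at every `G`-valued `U`, `G ≤ U(N)`) and dag-n06-w1's
`B9Thm31SiteGpKernelTorusDecayReg335Y.hs_GpY_deltaY_le_torus` (Theorem 3.1 by Agmon's method with an explicit admissible weight: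
`HS((G′(U)(δ_y ⊗ E))(x)) ≤ 256·(L^{lev x})²(L^{lev y})²·e^{−2δ₀|x−y|_T∕L^k}·HS(E)`, `δ₀ = 1∕(4(d+2))`, for every `U ∈ (bg9K (M_N ℂ) G i).Reg335 c α₀` with
`0 ≤ c·M·α₀`, `c·M·α₀·(d+1) ≤ 1∕16`).  THIS FILE reads the latter in the junction's kernel-bound currency (operator norm of record, `HS ≤ √N·op`, `op ≤ HS`,
`lev ≤ k`; a reading `ℓ` of NODE 00's sites into [13]'s unit torus enters through ONE displayed Lipschitz numeral `κ`: `κ·d₁(ℓ x, ℓ y) ≤ |x−y|_T∕L^k`) and composes.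

statement-level bookkeeping ([folklore] norm comparisons on `M_N(ℂ)`) + one composition over the cited tree theorems; kernel-checked; THEOREMS ONLY (no
`def`, no `structure`, no instance, no notation); NOTHING of NODE 00's ∕ N06's ∕ pv27's is modified; nothing here is a claim about the Yang–Mills mass gap; no
node is discharged; count-neutral.

WHY THIS FILE (cell `pub-ymgap`, HUMAN RULING D-0062 ∕ D-0149, Track A node N10 = [B13]; seat `pub-ymgap-dag-n10-c` g15, INTENT-4 = module 79).  The first
N06 → N10 knit in which «Theorem 3.1 at the centre» is a TREE THEOREM rather than a displayed binder (census v16 class «NODE A `hEL` for INVERSE pieces»: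
the G′-factor of the site sector, at the v4 letter, on the (3.35) class).

WHAT THIS FILE PROVES (all `theorem`s; `𝔸 = M_N(ℂ)`, `N ≥ 1`, L²-operator norm of record).
* §1 `single_eq_deltaY` (`δ_y ⊗ E` is NODE 00's `deltaY y E`), `sum_norm_sq_le_card_mul_opNorm_sq` (`HS(E)² ≤ N·‖E‖²`), `norm_unit_le_one_of_mem` (a `G`-valued
  background is a contraction pair: the pencil's size numeral is `K₀ = 1`), ★ `norm_GpY_parSymY_single_le_of_reg335` — n06-w1's decay in kernel-bound currency:
  `‖G′(U)(δ_x ⊗ E)(y)‖ ≤ 16·(L^k)²·√N·‖E‖·e^{−δ₀|y−x|_T∕L^k}` —, ★ `norm_GpY_parSymY_single_le_of_reg335_reading` (through `ℓ` with numeral `κ ≥ 0`: rate `δ₀κ`).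
* §2 ★★★ `rawEntryLetters_toMatrix_GpY_parSymY_prodCfg_of_reg335` — for a ℂ-basis `b` of `M_N(ℂ)` with numerals `cb, cl`: `RawEntryLetters (A′ ↦ toMatrix B′ B′
  (G′(e^{iηA′}U₀))) (ℓ ∘ fst) R₁⋆ ρ′ (2·cb·cl·16(L^k)²√N)` along the pencil for EVERY `U₀ ∈ Reg335 c α₀` (`G ≤ U(N)`, the two smallness inequalities of n06-w1's
  theorem) and every `0 ≤ ρ′ < δ₀κ`; remaining displayed: NODE 00's averaging numerals `D, Cavg`, the reading numerals `s, κ`, a fibre bound `m` of `ℓ`, `0 < Rc`;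
  ★★★ `rawEntryLetters_toMatrix_GpY_parSymY_prodCfg_of_reg335_record` — the same in matrix-unit coordinates (`cb = cl = 1`, n10-w2's `B13MatrixUnitBasisNumerals`).
HONEST FRAMING: a composition of cited tree theorems; n06-w1's declared scope carries over verbatim (one finite lattice operator; decay rate `δ₀∕L^k` per lattice step
at the coarsest scale, not print's multi-scale `d(y,y′)`); which reading `ℓ`, which `η`, and whether v4 `parSymY` is THE letter of the N10 term tower is NODE 00's ∕
def-T's word; the bond-sector `G = Δ_a⁻¹` (Thms 3.3 ∕ 3.10) is NOT touched; nothing of Bałaban's asserted beyond the cited theorems; N06 ∕ N10 NOT discharged;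
K1⁷ NOT closed; counts unmoved (typed 28∕28 · discharged 5∕27); 0 `def`, 0 `sorry`, standard axioms; one finite 𝕋⁴ programme at fixed ε — R4 closes the
conditional finite-𝕋⁴ rung `BalabanLadder.UV` only; the YM mass gap (Clay) is NOT proved by any of this; nothing continuum ∕ ℝ⁴ ∕ OS.

References: T. Bałaban, CMP 99 (1985) 389–434 [Balaban1985BackgroundPropagators] (3.24)–(3.25) p.394, (3.35) p.396, Thm 3.1 (3.42) p.397, (3.46) p.398, Thm 3.4 and
(3.50) p.400, (3.60)–(3.65) p.402, Thm 3.10 (3.107)–(3.108) pp.415–416; CMP 116 (1988) 1–22 [Balaban1988RG2Cluster] (2.5)–(2.7) pp.12–13, p.15; S. Agmon,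
*Lectures on exponential decay* (1982) [Agmon1982] Ch. 1.
-/

noncomputable section

namespace Literature.MathematicalPhysics.QuantumFieldTheory.Balaban1983to89.B13GreenPrimeSymLettersOfReg335

open Metric Set Finset Module
open scoped Matrix Matrix.Norms.L2Operator
open Literature.MathematicalPhysics.QuantumFieldTheory.Balaban1983to89
open Node00 B6KLevelCensusIndexV1 B6Geom246MultiLevelBox B6MultiLevelBoxOperator B6MultiLevelTorusOperator B6GlobalChartV1 B9BackgroundsKLevelV1
open Literature.MathematicalPhysics.QuantumFieldTheory.Balaban1983to89.B4TorusKernel.MultiPeriod (torusSupNorm torusSupNorm_nonneg)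
open Literature.MathematicalPhysics.QuantumFieldTheory.Balaban1983to89.B9Thm37GlueTorus (tdist1 tdist1_nonneg)
open Literature.MathematicalPhysics.QuantumFieldTheory.Balaban1983to89.B5TorusCover (UT)
open Literature.MathematicalPhysics.QuantumFieldTheory.Balaban1983to89.B13EntrywiseWalks (RawEntryLetters)
open Literature.MathematicalPhysics.QuantumFieldTheory.Balaban1983to89.B13OpsYPencilGreenPrimeSym (rawEntryLetters_toMatrix_GpY_parSymY_prodCfg_of_pencil)
open Literature.MathematicalPhysics.QuantumFieldTheory.Balaban1983to89.B13MatrixUnitBasisNumerals (norm_stdBasis_repr_le norm_stdBasis_le_one)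
open Literature.MathematicalPhysics.QuantumFieldTheory.Balaban1983to89.B9Thm31SiteGpKernelTorusDecayReg335Y (hs_GpY_deltaY_le_torus)
open Literature.MathematicalPhysics.QuantumFieldTheory.Balaban1983to89.B9Thm311DeltaPrimePos (isUnit_deltaPrimeAY_parSymY)
open Literature.MathematicalPhysics.QuantumFieldTheory.Balaban1983to89.B9Eq39Adjoint (prodCfg)

variable {d ℓ : ℕ} {hd : 1 ≤ d + 1} {hL : Odd (ℓ + 1) ∧ 1 < ℓ + 1} {b₀ b₁ : ℝ}
variable (i : KIdx d ℓ hd hL b₀ b₁) {N : ℕ} {G : Subgroup (Matrix (Fin N) (Fin N) ℂ)ˣ}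

/-! ## §1. n06-w1's kernel decay read in the junction's kernel-bound currency -/

section KernelBound

/-- NODE 00's `deltaY y E` IS the one-site field `δ_y ⊗ E`. [cite: Balaban1985BackgroundPropagators, (3.42) p.397 («supp λ ⊂ Δ(y′)»), dictionary] -/
theorem single_eq_deltaY {X : Type} [DecidableEq X] {𝔸 : Type} [NormedRing 𝔸] [NormedAlgebra ℂ 𝔸] [CompleteSpace 𝔸] (y : X) (E : 𝔸) :
    (Pi.single y E : X → 𝔸) = deltaY y E := by
  funext z
  by_cases h : z = y
  · subst h; simp [deltaY]
  · rw [Pi.single_eq_of_ne h]; simp [deltaY, h]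

/-- `HS(E)² ≤ N·‖E‖²` for the L²-operator norm (column by column). [folklore] [cite: Balaban1985Averaging, (17)–(20) pp.20–21, bookkeeping] -/
theorem sum_norm_sq_le_card_mul_opNorm_sq (E : Matrix (Fin N) (Fin N) ℂ) : ∑ a, ∑ b, ‖E a b‖ ^ 2 ≤ (N : ℝ) * ‖E‖ ^ 2 := by
  calc ∑ a, ∑ b, ‖E a b‖ ^ 2 = ∑ b, ∑ a, ‖E a b‖ ^ 2 := Finset.sum_comm
    _ ≤ ∑ _b : Fin N, ‖E‖ ^ 2 := Finset.sum_le_sum fun b _ => MatrixNorms.sum_norm_sq_col_le_opNorm_sq E b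
    _ = (N : ℝ) * ‖E‖ ^ 2 := by rw [Finset.sum_const, Finset.card_univ, Fintype.card_fin, nsmul_eq_mul]

/-- a `G`-valued background, `G ≤ U(N)`, is a contraction pair: `‖U(b)‖ ≤ 1`, `‖U(b)⁻¹‖ ≤ 1` (the pencil's size numeral `K₀ = 1`).
[cite: Balaban1985BackgroundPropagators, (3.35) p.396; Balaban1985Averaging, (19) p.21] -/
theorem norm_unit_le_one_of_mem [Nonempty (Fin N)] (hG : G ≤ B7Prop2Explicit.unitaryUnits (Matrix (Fin N) (Fin N) ℂ))
    {U : CfgY (Matrix (Fin N) (Fin N) ℂ) i} (hU : ∀ μ x, U μ x ∈ G) :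
    (∀ μ x, ‖(U μ x : Matrix (Fin N) (Fin N) ℂ)‖ ≤ 1) ∧
      ∀ μ x, ‖(((U μ x)⁻¹ : (Matrix (Fin N) (Fin N) ℂ)ˣ) : Matrix (Fin N) (Fin N) ℂ)‖ ≤ 1 :=
  ⟨fun μ x => (CStarRing.norm_of_mem_unitary (B7Prop2Explicit.mem_unitaryUnits.1 (hG (hU μ x)))).le,
    fun μ x => (CStarRing.norm_of_mem_unitary (B7Prop2Explicit.mem_unitaryUnits.1 (hG (G.inv_mem (hU μ x))))).le⟩

/-- ★ **THEOREM 3.1's KERNEL DECAY ON THE (3.35) CLASS IN KERNEL-BOUND CURRENCY** (n06-w1's `hs_GpY_deltaY_le_torus` read with `op ≤ HS ≤ √N·op` and `lev ≤ k`):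
`‖(G′(U)(δ_x ⊗ E))(y)‖ ≤ 16·(L^k)²·√N·‖E‖·e^{−δ₀|y−x|_T∕L^k}`, `δ₀ = 1∕(4(d+2))`, for every `U ∈ Reg335 c α₀`, `G ≤ U(N)`, `0 ≤ c·M·α₀`, `c·M·α₀·(d+1) ≤ 1∕16`.
[cite: Balaban1985BackgroundPropagators, Thm 3.1 (3.42) p.397, (3.46) p.398, (3.35) p.396, (3.107)–(3.108) p.416; Agmon1982, Ch.1] -/
theorem norm_GpY_parSymY_single_le_of_reg335 [Nonempty (Fin N)] (hG : G ≤ B7Prop2Explicit.unitaryUnits (Matrix (Fin N) (Fin N) ℂ))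
    {U : CfgY (Matrix (Fin N) (Fin N) ℂ) i} {c α₀ : ℝ} (hC0 : 0 ≤ c * (kGeo i).M * α₀) (hC1 : c * (kGeo i).M * α₀ * ((d : ℝ) + 1) ≤ 1 / 16)
    (hreg : (bg9K (Matrix (Fin N) (Fin N) ℂ) G i).Reg335 c α₀ U) (x y : SiteY i) (E : Matrix (Fin N) (Fin N) ℂ) :
    ‖GpY i (parSymY i) U (Pi.single x E) y‖ ≤
      16 * ((((ℓ + 1) ^ i.k : ℕ) : ℝ)) ^ 2 * Real.sqrt N * ‖E‖ *
        Real.exp (-((1 / (4 * ((d : ℝ) + 2))) * (((((ℓ + 1) ^ i.k : ℕ) : ℝ))⁻¹ * torusSupNorm (toKT i).NB (y.1 - x.1)))) := by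
  set Lk : ℝ := (((ℓ + 1) ^ i.k : ℕ) : ℝ) with hLk
  set δ₀ : ℝ := 1 / (4 * ((d : ℝ) + 2)) with hδ₀
  set r : ℝ := Lk⁻¹ * torusSupNorm (toKT i).NB (y.1 - x.1) with hr
  set v := GpY i (parSymY i) U (Pi.single x E) y with hv
  have hS := hs_GpY_deltaY_le_torus i hG hC0 hC1 hreg y x E
  rw [← single_eq_deltaY] at hS
  have h1 : ‖v‖ ^ 2 ≤ ∑ a, ∑ b, ‖v a b‖ ^ 2 := MatrixNorms.opNorm_sq_le_sum_norm_sq v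
  have h2 : ∑ a, ∑ b, ‖E a b‖ ^ 2 ≤ (N : ℝ) * ‖E‖ ^ 2 := sum_norm_sq_le_card_mul_opNorm_sq E
  have hL1 : (1 : ℝ) ≤ (ℓ : ℝ) + 1 := by linarith [Nat.cast_nonneg (α := ℝ) ℓ]
  have hLy : (((ℓ + 1) ^ (blkOf i.D.toDomains y).1.1 : ℕ) : ℝ) ≤ Lk := by
    rw [hLk]; exact_mod_cast Nat.pow_le_pow_right (Nat.succ_pos ℓ) (B9GeoNormsKLevelV1.blkOf_level_le i y)
  have hLx : (((ℓ + 1) ^ (blkOf i.D.toDomains x).1.1 : ℕ) : ℝ) ≤ Lk := by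
    rw [hLk]; exact_mod_cast Nat.pow_le_pow_right (Nat.succ_pos ℓ) (B9GeoNormsKLevelV1.blkOf_level_le i x)
  have hLy0 : (0 : ℝ) ≤ (((ℓ + 1) ^ (blkOf i.D.toDomains y).1.1 : ℕ) : ℝ) := Nat.cast_nonneg _
  have hLx0 : (0 : ℝ) ≤ (((ℓ + 1) ^ (blkOf i.D.toDomains x).1.1 : ℕ) : ℝ) := Nat.cast_nonneg _
  have hLk0 : 0 ≤ Lk := Nat.cast_nonneg _
  have hN0 : (0 : ℝ) ≤ N := Nat.cast_nonneg _
  have hexp : 0 < Real.exp (δ₀ * r) := Real.exp_pos _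
  have hE0 : 0 ≤ ∑ a, ∑ b, ‖E a b‖ ^ 2 := Finset.sum_nonneg fun _ _ => Finset.sum_nonneg fun _ _ => sq_nonneg _
  set C : ℝ := 16 * Lk ^ 2 * Real.sqrt N * ‖E‖ * Real.exp (-(δ₀ * r)) with hC
  have hC0' : 0 ≤ C := by
    rw [hC]; exact mul_nonneg (mul_nonneg (mul_nonneg (by positivity) (Real.sqrt_nonneg _)) (norm_nonneg _)) (Real.exp_nonneg _)
  have key : ‖v‖ ^ 2 ≤ C ^ 2 := by
    calc ‖v‖ ^ 2 ≤ ∑ a, ∑ b, ‖v a b‖ ^ 2 := h1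
      _ ≤ 256 * ((((ℓ + 1) ^ (blkOf i.D.toDomains y).1.1 : ℕ) : ℝ) ^ 2 * (((ℓ + 1) ^ (blkOf i.D.toDomains x).1.1 : ℕ) : ℝ) ^ 2 /
            Real.exp (δ₀ * r) ^ 2) * ∑ a, ∑ b, ‖E a b‖ ^ 2 := hS
      _ ≤ 256 * (Lk ^ 2 * Lk ^ 2 / Real.exp (δ₀ * r) ^ 2) * ((N : ℝ) * ‖E‖ ^ 2) := by
          gcongr
      _ = C ^ 2 := by
          rw [hC]
          simp only [mul_pow, div_eq_mul_inv, Real.exp_neg, inv_pow, Real.sq_sqrt hN0]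
          ring
  calc ‖v‖ = Real.sqrt (‖v‖ ^ 2) := (Real.sqrt_sq (norm_nonneg _)).symm
    _ ≤ Real.sqrt (C ^ 2) := Real.sqrt_le_sqrt key
    _ = C := Real.sqrt_sq hC0'

variable {ν : ℕ} {Nf : Fin ν → ℕ} [∀ j, NeZero (Nf j)]

/-- ★ **… THROUGH A READING** `ℓ : SiteY i → UT Nf` of NODE 00's sites into [13]'s unit torus with ONE displayed Lipschitz numeral `κ ≥ 0`
(`κ·d₁(ℓ z, ℓ w) ≤ |z−w|_T∕L^k`): `‖(G′(U)(δ_x ⊗ E))(y)‖ ≤ 16·(L^k)²·√N·‖E‖·e^{−(δ₀κ)·d₁(ℓ y, ℓ x)}` — EXACTLY the junction's input `hO`.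
[cite: Balaban1985BackgroundPropagators, Thm 3.1 (3.42) p.397, (3.107)–(3.108) p.416; Balaban1988RG2Cluster, (2.5) p.12, p.15] -/
theorem norm_GpY_parSymY_single_le_of_reg335_reading [Nonempty (Fin N)] (hG : G ≤ B7Prop2Explicit.unitaryUnits (Matrix (Fin N) (Fin N) ℂ))
    {U : CfgY (Matrix (Fin N) (Fin N) ℂ) i} {c α₀ : ℝ} (hC0 : 0 ≤ c * (kGeo i).M * α₀) (hC1 : c * (kGeo i).M * α₀ * ((d : ℝ) + 1) ≤ 1 / 16)
    (hreg : (bg9K (Matrix (Fin N) (Fin N) ℂ) G i).Reg335 c α₀ U)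
    (ℓ' : SiteY i → UT Nf) {κr : ℝ}
    (hκ : ∀ z w : SiteY i, κr * tdist1 Nf (ℓ' z) (ℓ' w) ≤ ((((ℓ + 1) ^ i.k : ℕ) : ℝ))⁻¹ * torusSupNorm (toKT i).NB (z.1 - w.1))
    (x y : SiteY i) (E : Matrix (Fin N) (Fin N) ℂ) :
    ‖GpY i (parSymY i) U (Pi.single x E) y‖ ≤
      16 * ((((ℓ + 1) ^ i.k : ℕ) : ℝ)) ^ 2 * Real.sqrt N * ‖E‖ * Real.exp (-((1 / (4 * ((d : ℝ) + 2)) * κr) * tdist1 Nf (ℓ' y) (ℓ' x))) := by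
  refine (norm_GpY_parSymY_single_le_of_reg335 i hG hC0 hC1 hreg x y E).trans (mul_le_mul_of_nonneg_left (Real.exp_le_exp.2 ?_) ?_)
  · rw [neg_le_neg_iff, mul_assoc]
    exact mul_le_mul_of_nonneg_left (hκ y x) (by positivity)
  · exact mul_nonneg (mul_nonneg (by positivity) (Real.sqrt_nonneg _)) (norm_nonneg _)

end KernelBound

/-! ## §2. ★★★ The G′-factor's N10 letters along the pencil for every background of the (3.35) class -/

section Knit

variable [NeZero N]
variable {κ : Type} [Fintype κ] [DecidableEq κ] (b : Basis κ ℂ (Matrix (Fin N) (Fin N) ℂ))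
variable {ν : ℕ} {Nf : Fin ν → ℕ} [∀ j, NeZero (Nf j)]

/-- ★★★ **THE N06 → N10 KNIT FOR THE G′-FACTOR.**  For EVERY background `U₀ ∈ (bg9K (M_N ℂ) G i).Reg335 c α₀` (`G ≤ U(N)`, `0 ≤ c·M·α₀`, `c·M·α₀·(d+1) ≤ 1∕16`), along
pv27's pencil `A′ ↦ e^{iηA′}U₀`, the matrices of `G′ = GpY i (parSymY i)` in a product basis have the N10 letters
`RawEntryLetters (A′ ↦ toMatrix B′ B′ (G′(e^{iηA′}U₀))) (ℓ ∘ fst) R₁⋆ ρ′ (2·cb·cl·B_G)`, `B_G = 16·(L^k)²·√N`, at the located thin radius, for every target rate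
`0 ≤ ρ′ < δ₀κ` — INVERTIBILITY AND THEOREM 3.1 AT THE CENTRE SUPPLIED BY N06's TREE THEOREMS (`isUnit_deltaPrimeAY_parSymY`, `hs_GpY_deltaY_le_torus`), the background's
size numeral `K₀ = 1` by unitarity.  Remaining displayed: NODE 00's averaging numerals (`D`, `Cavg`), the reading numerals (`s`: one lattice step ∕ one averaging
coefficient; `κ`: torus Lipschitz), the basis numerals `cb, cl`, a fibre bound `m` of `ℓ`, `0 < Rc`.
[cite: Balaban1985BackgroundPropagators, (3.24)–(3.25) p.394, (3.35) p.396, Thm 3.1 (3.42) p.397, Thm 3.4 and (3.50) p.400, (3.60)–(3.65) p.402, Thm 3.10 (3.107)–(3.108) p.416;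
Balaban1988RG2Cluster, (2.5)–(2.7) pp.12–13, p.15; Balaban1984PropagatorsII, Lemma 2.1 (2.61) p.234; Agmon1982, Ch.1] -/
theorem rawEntryLetters_toMatrix_GpY_parSymY_prodCfg_of_reg335
    (hG : G ≤ B7Prop2Explicit.unitaryUnits (Matrix (Fin N) (Fin N) ℂ))
    {U₀ : CfgY (Matrix (Fin N) (Fin N) ℂ) i} {c α₀ : ℝ} (hC0 : 0 ≤ c * (kGeo i).M * α₀) (hC1 : c * (kGeo i).M * α₀ * ((d : ℝ) + 1) ≤ 1 / 16)
    (hreg : (bg9K (Matrix (Fin N) (Fin N) ℂ) G i).Reg335 c α₀ U₀)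
    (η : ℝ) {Rc : ℝ} (hRc : 0 < Rc) {D : ℕ}
    (hD : ∀ z w, avgCoeffY i z w ≠ 0 →
      Site.tdist ((boxEquiv i.hN).symm z) ((boxEquiv i.hN).symm (cornerY i (levY i z) z)) +
        Site.tdist ((boxEquiv i.hN).symm (cornerY i (levY i z) z)) ((boxEquiv i.hN).symm w) ≤ D)
    {Cavg : ℝ} (hCavg0 : 0 ≤ Cavg) (hCavg : ∀ z, ∑ w, |avgCoeffY i z w| ≤ Cavg)
    {cb cl : ℝ} (hcb : ∀ (a : Matrix (Fin N) (Fin N) ℂ) (k : κ), ‖b.repr a k‖ ≤ cb * ‖a‖) (hcb0 : 0 ≤ cb) (hcl : ∀ l, ‖b l‖ ≤ cl) (hcl0 : 0 ≤ cl)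
    (ℓ' : SiteY i → UT Nf) {s : ℝ} (hs0 : 0 ≤ s)
    (hℓ : ∀ μ z, tdist1 Nf (ℓ' (shiftY i μ z)) (ℓ' z) ≤ s) (hℓa : ∀ z w, avgCoeffY i z w ≠ 0 → tdist1 Nf (ℓ' z) (ℓ' w) ≤ s)
    {κr : ℝ} (hκ0 : 0 ≤ κr)
    (hκ : ∀ z w : SiteY i, κr * tdist1 Nf (ℓ' z) (ℓ' w) ≤ ((((ℓ + 1) ^ i.k : ℕ) : ℝ))⁻¹ * torusSupNorm (toKT i).NB (z.1 - w.1))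
    {m : ℕ} (hfib : ∀ y : UT Nf, (univ.filter fun p : SiteY i × κ => ℓ' p.1 = y).card ≤ m)
    {ρ' : ℝ} (hρ'0 : 0 ≤ ρ') (hρ' : ρ' < (1 / (4 * ((d : ℝ) + 2))) * κr) :
    RawEntryLetters (fun a : Fin (d + 1) → Site (PV d ℓ i.m i.K hd hL) 0 → Matrix (Fin N) (Fin N) ℂ =>
        LinearMap.toMatrix ((Pi.basis fun _ : SiteY i => b).reindex (Equiv.sigmaEquivProd (SiteY i) κ))
          ((Pi.basis fun _ : SiteY i => b).reindex (Equiv.sigmaEquivProd (SiteY i) κ)) (GpY i (parSymY i) (prodCfg U₀ η a)))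
      (fun p : SiteY i × κ => ℓ' p.1)
      (Rc / (4 * ((cb * (((d : ℝ) + 1) *
          (1 * Real.exp (|η| * Rc) * (1 * Real.exp (|η| * Rc) * cl * (1 * Real.exp (|η| * Rc)) + cl) * (1 * Real.exp (|η| * Rc)) +
            (1 * Real.exp (|η| * Rc) * cl * (1 * Real.exp (|η| * Rc)) + cl)) +
          Cavg * ((1 * Real.exp (|η| * Rc)) ^ D * cl * (1 * Real.exp (|η| * Rc)) ^ D)) * Real.exp ((1 / (4 * ((d : ℝ) + 2)) * κr) * s)) *
          (cb * cl * (16 * ((((ℓ + 1) ^ i.k : ℕ) : ℝ)) ^ 2 * Real.sqrt N)) *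
          (m * B6.c0 1 (((1 / (4 * ((d : ℝ) + 2))) * κr - ρ') / 3) ^ ν) * (m * B6.c0 1 (((1 / (4 * ((d : ℝ) + 2))) * κr - ρ') / 3) ^ ν)) + 1))
      ρ' (2 * (cb * cl * (16 * ((((ℓ + 1) ^ i.k : ℕ) : ℝ)) ^ 2 * Real.sqrt N))) := by
  obtain ⟨hU, hUi⟩ := norm_unit_le_one_of_mem i hG hreg.1
  have hunit : IsUnit (deltaPrimeAY i (parSymY i) U₀) := isUnit_deltaPrimeAY_parSymY i hG hreg.1
  have hBG : 0 ≤ 16 * ((((ℓ + 1) ^ i.k : ℕ) : ℝ)) ^ 2 * Real.sqrt N := mul_nonneg (by positivity) (Real.sqrt_nonneg _)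
  have hρ : 0 ≤ (1 / (4 * ((d : ℝ) + 2))) * κr := mul_nonneg (by positivity) hκ0
  exact rawEntryLetters_toMatrix_GpY_parSymY_prodCfg_of_pencil i U₀ η b hU hUi le_rfl hRc hD hCavg0 hCavg hcb hcb0 hcl hcl0 ℓ' hs0 hℓ hℓa hfib
    hunit hBG hρ (fun x y E => norm_GpY_parSymY_single_le_of_reg335_reading i hG hC0 hC1 hreg ℓ' hκ x y E) hρ'0 hρ'

/-- ★★★ **… AT THE RECORD's COORDINATES** (matrix units `Matrix.stdBasis ℂ (Fin N) (Fin N)`, `cb = cl = 1` by n10-w2's `B13MatrixUnitBasisNumerals`): no basis binder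
left. [cite: Balaban1985BackgroundPropagators, (3.24)–(3.25) p.394, (3.35) p.396, Thm 3.1 (3.42) p.397, Thm 3.4 p.400, (3.60)–(3.65) p.402, Thm 3.10 (3.107)–(3.108) p.416;
Balaban1988RG2Cluster, (2.5)–(2.7) pp.12–13, p.15] -/
theorem rawEntryLetters_toMatrix_GpY_parSymY_prodCfg_of_reg335_record
    (hG : G ≤ B7Prop2Explicit.unitaryUnits (Matrix (Fin N) (Fin N) ℂ))
    {U₀ : CfgY (Matrix (Fin N) (Fin N) ℂ) i} {c α₀ : ℝ} (hC0 : 0 ≤ c * (kGeo i).M * α₀) (hC1 : c * (kGeo i).M * α₀ * ((d : ℝ) + 1) ≤ 1 / 16)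
    (hreg : (bg9K (Matrix (Fin N) (Fin N) ℂ) G i).Reg335 c α₀ U₀)
    (η : ℝ) {Rc : ℝ} (hRc : 0 < Rc) {D : ℕ}
    (hD : ∀ z w, avgCoeffY i z w ≠ 0 →
      Site.tdist ((boxEquiv i.hN).symm z) ((boxEquiv i.hN).symm (cornerY i (levY i z) z)) +
        Site.tdist ((boxEquiv i.hN).symm (cornerY i (levY i z) z)) ((boxEquiv i.hN).symm w) ≤ D)
    {Cavg : ℝ} (hCavg0 : 0 ≤ Cavg) (hCavg : ∀ z, ∑ w, |avgCoeffY i z w| ≤ Cavg)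
    (ℓ' : SiteY i → UT Nf) {s : ℝ} (hs0 : 0 ≤ s)
    (hℓ : ∀ μ z, tdist1 Nf (ℓ' (shiftY i μ z)) (ℓ' z) ≤ s) (hℓa : ∀ z w, avgCoeffY i z w ≠ 0 → tdist1 Nf (ℓ' z) (ℓ' w) ≤ s)
    {κr : ℝ} (hκ0 : 0 ≤ κr)
    (hκ : ∀ z w : SiteY i, κr * tdist1 Nf (ℓ' z) (ℓ' w) ≤ ((((ℓ + 1) ^ i.k : ℕ) : ℝ))⁻¹ * torusSupNorm (toKT i).NB (z.1 - w.1))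
    {m : ℕ} (hfib : ∀ y : UT Nf, (univ.filter fun p : SiteY i × (Fin N × Fin N) => ℓ' p.1 = y).card ≤ m)
    {ρ' : ℝ} (hρ'0 : 0 ≤ ρ') (hρ' : ρ' < (1 / (4 * ((d : ℝ) + 2))) * κr) :
    RawEntryLetters (fun a : Fin (d + 1) → Site (PV d ℓ i.m i.K hd hL) 0 → Matrix (Fin N) (Fin N) ℂ =>
        LinearMap.toMatrix
          ((Pi.basis fun _ : SiteY i => Matrix.stdBasis ℂ (Fin N) (Fin N)).reindex (Equiv.sigmaEquivProd (SiteY i) (Fin N × Fin N)))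
          ((Pi.basis fun _ : SiteY i => Matrix.stdBasis ℂ (Fin N) (Fin N)).reindex (Equiv.sigmaEquivProd (SiteY i) (Fin N × Fin N)))
          (GpY i (parSymY i) (prodCfg U₀ η a)))
      (fun p : SiteY i × (Fin N × Fin N) => ℓ' p.1)
      (Rc / (4 * ((1 * (((d : ℝ) + 1) *
          (1 * Real.exp (|η| * Rc) * (1 * Real.exp (|η| * Rc) * 1 * (1 * Real.exp (|η| * Rc)) + 1) * (1 * Real.exp (|η| * Rc)) +
            (1 * Real.exp (|η| * Rc) * 1 * (1 * Real.exp (|η| * Rc)) + 1)) +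
          Cavg * ((1 * Real.exp (|η| * Rc)) ^ D * 1 * (1 * Real.exp (|η| * Rc)) ^ D)) * Real.exp ((1 / (4 * ((d : ℝ) + 2)) * κr) * s)) *
          (1 * 1 * (16 * ((((ℓ + 1) ^ i.k : ℕ) : ℝ)) ^ 2 * Real.sqrt N)) *
          (m * B6.c0 1 (((1 / (4 * ((d : ℝ) + 2))) * κr - ρ') / 3) ^ ν) * (m * B6.c0 1 (((1 / (4 * ((d : ℝ) + 2))) * κr - ρ') / 3) ^ ν)) + 1))
      ρ' (2 * (1 * 1 * (16 * ((((ℓ + 1) ^ i.k : ℕ) : ℝ)) ^ 2 * Real.sqrt N))) :=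
  rawEntryLetters_toMatrix_GpY_parSymY_prodCfg_of_reg335 i (Matrix.stdBasis ℂ (Fin N) (Fin N)) hG hC0 hC1 hreg η hRc hD hCavg0 hCavg
    norm_stdBasis_repr_le zero_le_one norm_stdBasis_le_one zero_le_one ℓ' hs0 hℓ hℓa hκ0 hκ hfib hρ'0 hρ'

end Knit

end Literature.MathematicalPhysics.QuantumFieldTheory.Balaban1983to89.B13GreenPrimeSymLettersOfReg335

end
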